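import Mathlib
import Summits.ValiantsHypothesis.ValiantsHypothesis.Theorems.NewtonTauWeak.Negative.Zonogon
import Summits.ValiantsHypothesis.ValiantsHypothesis.Theorems.NewtonUnitEquationsNewtonTauWeakSeparatedRank
import Summits.ValiantsHypothesis.ValiantsHypothesis.Theorems.NewtonUnitEquationsNewtonTauWeakVdpDefs
import Summits.ValiantsHypothesis.ValiantsHypothesis.Theorems.NewtonUnitEquationsNewtonTauWeakStubVertexCharts
import Summits.ValiantsHypothesis.ValiantsHypothesis.Theorems.NewtonUnitEquationsNewtonTauWeakStubChartPairCount
import Summits.ValiantsHypothesis.ValiantsHypothesis.Theorems.NewtonUnitEquationsNewtonTauWeakStubProductVertices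
import Summits.ValiantsHypothesis.ValiantsHypothesis.Theorems.NewtonUnitEquationsNewtonTauWeakHexagonDelta
import Summits.ValiantsHypothesis.ValiantsHypothesis.Theorems.NewtonUnitEquationsNewtonTauWeakHexagonTrichotomy

/-!
# `NewtonUnitEquationsNewtonTauWeakHexagonDichotomy`

Rung toward `stub_binomialNewtonTauCommon` (T2 = KPTT Conj. 1 at `t = 2`; crux `NewtonTauWeak`,
stmt-ValiantsHypothesis-5904), line `binomial-normal-form`, lead c3: the ALL-`K` hexagon theorem `H_K`
("`vert(Σ_{l<K} X_l(x)Y_l(y)D_l(xy)) ≤ C(K)`, degree-free") via the HOMOGENEOUS Wronskian equation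
(card `Cruxes/NewtonTauWeak/Lines/binomial-normal-form-delta-global.md` §2).

This file: the KEY DICHOTOMY `hex_key_dichotomy` — the `Fin (n+1)` / right-hand-side-zero version of the landed `hex_key_trichotomy` (…HexagonTrichotomy.lean): at an off-diagonal strict top `v` of `F`, the coefficient of `X^{z+v}` in `Σ_i (-1)^i N_i·Δ^i F` is `F_v · Σ_i (-1)^i coeff_z(N_i) σ^i` (all other monomials lighter), so the identity `= 0` forces the sum to vanish.

Conventions (inline, no definitions): `Δ` is ANY self-map of `ℂ[X,Y]` with `coeff e (Δ p) = (e₀ - e₁) · coeff e p`;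
"x-only" `∀ e ∈ P.support, e 1 = 0`, "y-only" `e 0 = 0`, "diagonal" `e 0 = e 1`; "separated of rank R":
`m = Σ_{r<R} P_r·Q_r` with `P_r` x-only, `Q_r` y-only. [folklore]
-/

set_option linter.dupNamespace false

noncomputable section

namespace Summit.ValiantsHypothesis.ValiantsHypothesis.Theorems.NewtonUnitEquationsNewtonTauWeak

open scoped BigOperators
open MvPolynomial
open Literature.Computability.AlgebraicComplexity (newtonVertexCount)
open Summit.ValiantsHypothesis.ValiantsHypothesis.Theorems.NewtonTauWeakVdp
open Summit.ValiantsHypothesis.ValiantsHypothesis.Theorems.NewtonTauWeak.Negative (vert)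

/-- H1 **Key dichotomy (homogeneous `Δ`-equation of any order).** If `Σ_{i≤n} (-1)^i N_i · Δ^i F = 0`, `w` is
generic, `v` is the strict top of `F` with `v₀ ≠ v₁`, and `z` is the strict top of a polynomial `U` whose support is
the union of the supports of the `N_i`, then `Σ_i (-1)^i coeff_z(N_i) σ^i = 0` with `σ = v₀ - v₁`. [folklore] -/
theorem hex_key_dichotomy (Δ : MvPolynomial (Fin 2) ℂ → MvPolynomial (Fin 2) ℂ)
    (hΔ : ∀ p e, coeff e (Δ p) = (((e 0 : ℕ) : ℂ) - ((e 1 : ℕ) : ℂ)) * coeff e p)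
    {n : ℕ} (N : Fin (n + 1) → MvPolynomial (Fin 2) ℂ) (F U : MvPolynomial (Fin 2) ℂ)
    (hid : ∑ i : Fin (n + 1), (-1 : MvPolynomial (Fin 2) ℂ) ^ (i : ℕ) * (N i * (Δ^[(i : ℕ)]) F) = 0)
    (hU : ∀ e, e ∈ U.support ↔ ∃ i, e ∈ (N i).support)
    {w : Fin 2 → ℝ} (hw : IsGeneric w) {v z : Fin 2 →₀ ℕ} (hv : IsTop w F v) (hσ : v 0 ≠ v 1)
    (hz : IsTop w U z) :
    ∑ i : Fin (n + 1), (-1 : ℂ) ^ (i : ℕ) * coeff z (N i) * ((((v 0 : ℕ) : ℂ)) - ((v 1 : ℕ) : ℂ)) ^ (i : ℕ) = 0 := by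
  classical
  set σv : ℂ := (((v 0 : ℕ) : ℂ)) - ((v 1 : ℕ) : ℂ) with hσv
  -- (1) the iterates `Δ^[i] F` keep the strict top `v`, with coefficient `σ^i · F_v`
  have hiter : ∀ i : ℕ, IsTop w (Δ^[i] F) v ∧ coeff v (Δ^[i] F) = σv ^ i * coeff v F := by
    intro i
    induction i with
    | zero =>
      show IsTop w F v ∧ coeff v F = σv ^ 0 * coeff v F
      exact ⟨hv, by rw [pow_zero, one_mul]⟩
    | succ i ih =>
      rw [Function.iterate_succ_apply']
      exact ⟨hex_isTop_delta Δ hΔ ih.1 hσ, by rw [hΔ, ih.2, pow_succ]; ring⟩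
  -- (2) every support exponent of `N i` weighs at most `z`
  have hN : ∀ i, ∀ a ∈ (N i).support, wdeg w a ≤ wdeg w z :=
    fun i a ha => hz.le ((hU a).mpr ⟨i, ha⟩)
  -- (3) the coefficient of `X^{z+v}` in each summand
  have hc : ∀ i : Fin (n + 1),
      coeff (z + v) ((-1 : MvPolynomial (Fin 2) ℂ) ^ (i : ℕ) * (N i * (Δ^[(i : ℕ)]) F)) =
        (-1 : ℂ) ^ (i : ℕ) * (coeff z (N i) * (σv ^ (i : ℕ) * coeff v F)) := by
    intro i
    have hC : (-1 : MvPolynomial (Fin 2) ℂ) ^ (i : ℕ) = C ((-1 : ℂ) ^ (i : ℕ)) := by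
      rw [map_pow, map_neg, map_one]
    rw [hC, coeff_C_mul, hex_coeff_mul_add_of_dominant hw (N i) _ z v (hN i)
      (HexagonTrichotomy.le_of_isTop (hiter i).1), (hiter i).2]
  -- (4) compare coefficients of `X^{z+v}` in the identity
  have hsum : coeff (z + v) (∑ i : Fin (n + 1),
      (-1 : MvPolynomial (Fin 2) ℂ) ^ (i : ℕ) * (N i * (Δ^[(i : ℕ)]) F)) =
      coeff v F * ∑ i : Fin (n + 1), (-1 : ℂ) ^ (i : ℕ) * coeff z (N i) * σv ^ (i : ℕ) := by
    rw [coeff_sum, Finset.mul_sum]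
    refine Finset.sum_congr rfl fun i _ => ?_
    rw [hc i]; ring
  rw [hid, coeff_zero] at hsum
  have hFv : coeff v F ≠ 0 := mem_support_iff.mp hv.mem
  exact (mul_eq_zero.mp hsum.symm).resolve_left hFv


end Summit.ValiantsHypothesis.ValiantsHypothesis.Theorems.NewtonUnitEquationsNewtonTauWeak

end
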